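import Literature.Analysis.FluidPDE.TaoWhitneyKernel
import Literature.Analysis.FluidPDE.TaoWhitneyCover
import Literature.Analysis.FluidPDE.TaoWhitneyChaining
import Literature.Analysis.FluidPDE.TaoLocalVelocityGradient
import Literature.Analysis.FluidPDE.LocalSobolevBall
import Literature.Analysis.FluidPDE.PoincareBall
import Mathlib.MeasureTheory.Integral.MeanInequalities
import HarnessLib

/-!
# Tao (2011/2013), proof of Thm. 10.1: the per-ball toolkit for the `Y₆` estimate on a discrete
# Whitney family of the annulus

Support file for the discharge of `tao2011_nonlinearEstimate` (T. Tao, *Localisation and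
compactness properties of the Navier–Stokes global regularity problem*, arXiv:1108.1165, §10,
proof of Thm. 10.1, pp. 32–33), organised around a *discrete* Whitney family
(`IsWhitneyFamily`, `TaoWhitneyCover.lean`) of the annulus `{d > 0}`
(`annDepth`/`whitneyRadius`, `TaoWhitneyKernel.lean`) and the parent-ball chaining of
`TaoWhitneyChaining.lean`. Everything here concerns **one ball** (or one pair of adjacent balls):

* `Y6.exists_annDepth_eq_add`, `Y6.exists_parent` — radial escape in the annulus and the
  **parent** of a small Whitney ball (p. 33: "a 'parent' ball `B_{p(i)}` which touches the ball but
  has radius at least `1.001` as large"): a centre `p` of the family with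
  `(103/101)ρ(x) ≤ ρ(p) ≤ (104/99)ρ(x)`, `|x − p| ≤ 5ρ(x)`;
* `Y6.setLIntegral_sq_mul_le` — the two Hölder inequalities
  `∫_B f²g ≤ (∫_B f⁶)^{1/3}(∫ g²)^{1/2}|B|^{1/6}` (p. 32, "From Hölder's inequality");
* `Y6.exists_lintegral_six_ball_le` — the local Sobolev inequality on balls in squared `ℝ≥0∞`
  form (tree `LocalSobolevBall.eLpNorm_six_ball_le`);
* `Y6.exists_local_velocityGradient_bound_ennreal` — the local velocity-gradient bound of
  `TaoLocalVelocityGradient.lean` in `ℝ≥0∞` form;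
* `Y6.rms`, `Y6.rms_le_rms_add` — the root-mean-square `wᵢ` of `|ω|` on `9Bᵢ` and the
  **Poincaré comparison (10.24)** of adjacent averages,
  `|m(w) − m(p)| ≤ C_P ρ_w^{-1/2}‖∇ω‖_{L²(B(w,15ρ_w))}` (tree `PoincareBall`, Minkowski in `L²`);
* `Y6.setLIntegral_whitneyBall_le` — **`Y₆` on one Whitney ball**:
  `∫_B|ω|²|Du|η ≤ 101kρ (S (∫F²)^{1/2}|B|^{1/6} + Cρ⁻⁴(∫_{4B}|u|)∫_B|ω|²)`;
* the weight bookkeeping (10.20) on dilated balls in `ℝ≥0∞` form, the layer `{0 < d < k⁻¹}` as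
  the union of the two transition shells, small balls lie in the layer, big balls carry weight
  `≥ 0.891`.

## Mathlib / tree search

Tree (reused): `TaoWhitneyKernel` (`annDepth`, `whitneyRadius`, (10.20)), `TaoWhitneyCover`
(`IsWhitneyFamily`), `TaoLocalVelocityGradient`, `LocalSobolevBall`, `PoincareBall`
(`lintegral_ball_sub_average_sq_le`, `add_sq_le_two_mul_sq_add`); Mathlib:
`ENNReal.lintegral_mul_le_Lp_mul_Lq`, `ENNReal.lintegral_Lp_add_le`, `Measure.addHaar_ball`.
Parallel single-ball estimates exist in the tree in other normalisations (`TaoY6BallEstimate`,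
`TaoY6ChainStep`, for the continuous decomposition); the present file is the form consumed by the
discrete-family summation.

## References

* T. Tao, *Localisation and compactness properties of the Navier–Stokes global regularity
  problem*, Anal. PDE 6 (2013) 25–107 = arXiv:1108.1165 (`Tao2011`), §10, proof of Thm. 10.1,
  pp. 32–33.
-/

noncomputable section

open MeasureTheory Set Metric Filter Function
open scoped ENNReal NNReal Topology

namespace Literature.Analysis.FluidPDE

namespace Y6

/-- Local notation for physical space. -/
local notation "ℝ³" => EuclideanSpace ℝ (Fin 3)

section Escape

variable {x₀ : ℝ³} {a b : ℝ}

/-- **Radial escape in the annulus**: from a point of positive depth one can move a distance `t`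
towards the middle sphere and gain exactly `t` in depth, as long as one does not cross the
middle: `d(y) = d(x) + t` with `|x − y| = t` whenever `d(x) + t ≤ (b − a)/2` (`a > 0`). [folklore] -/
theorem exists_annDepth_eq_add (ha : 0 < a) {x : ℝ³} (hx : 0 < annDepth x₀ a b x) {t : ℝ}
    (ht : 0 ≤ t) (htd : annDepth x₀ a b x + t ≤ (b - a) / 2) :
    ∃ y : ℝ³, dist x y = t ∧ annDepth x₀ a b y = annDepth x₀ a b x + t := by
  set r := ‖x - x₀‖ with hr
  obtain ⟨har, hrb⟩ := (annDepth_pos_iff x).1 hx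
  have hr0 : 0 < r := ha.trans har
  set e : ℝ³ := r⁻¹ • (x - x₀) with he
  have he1 : ‖e‖ = 1 := by
    rw [he, norm_smul, norm_inv, Real.norm_of_nonneg hr0.le, inv_mul_cancel₀ hr0.ne']
  have hxe : x - x₀ = r • e := by
    rw [he, smul_smul, mul_inv_cancel₀ hr0.ne', one_smul]
  rw [annDepth_def] at htd ⊢
  rcases le_or_gt (r - a) (b - r) with h | h
  · -- inner half: move outwards
    have hd : min (r - a) (b - r) = r - a := min_eq_left h
    rw [hd] at htd
    refine ⟨x + t • e, ?_, ?_⟩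
    · rw [dist_eq_norm, sub_add_cancel_left, norm_neg, norm_smul, he1, mul_one,
        Real.norm_of_nonneg ht]
    · have hy : ‖x + t • e - x₀‖ = r + t := by
        rw [show x + t • e - x₀ = (r + t) • e by rw [add_smul, ← hxe]; abel, norm_smul, he1,
          mul_one, Real.norm_of_nonneg (by linarith)]
      rw [annDepth_def, hy, hd, min_eq_left (by linarith)]
      ring
  · -- outer half: move inwards
    have hd : min (r - a) (b - r) = b - r := min_eq_right h.le
    rw [hd] at htd
    refine ⟨x - t • e, ?_, ?_⟩
    · rw [dist_eq_norm, sub_sub_cancel, norm_smul, he1, mul_one, Real.norm_of_nonneg ht]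
    · have hy : ‖x - t • e - x₀‖ = r - t := by
        rw [show x - t • e - x₀ = (r - t) • e by rw [sub_smul, ← hxe]; abel, norm_smul, he1,
          mul_one, Real.norm_of_nonneg (by linarith)]
      rw [annDepth_def, hy, hd, min_eq_right (by linarith)]
      ring

end Escape

/-! ## The parent map on a Whitney family of the annulus -/

section Parent

variable {x₀ : ℝ³} {a b k : ℝ}

/-- **Existence of parents** (Tao 2011, p. 33: "for any small ball `Bᵢ`, we may assign a
'parent' ball `B_{p(i)}` which touches the ball but has radius at least `1.001` as large"): in a
Whitney family of the annulus `{d > 0}` for the radius `ρ = whitneyRadius x₀ a b k` (`a > 0`,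
`a + 2k⁻¹ < b`), every centre `x` of depth `d(x) < 0.9 k⁻¹` has a centre `p` with
`(103/101) ρ(x) ≤ ρ(p)`, `ρ(p) ≤ (104/99) ρ(x)` and `|x − p| ≤ 5 ρ(x)` (escape radially by `3ρ(x)`
and take a ball of the cover through the end-point). [cite: Tao2011, §10, proof of Thm. 10.1 (parent-ball chaining, p. 33)] -/
theorem exists_parent (ha : 0 < a) (hk : 0 < k) (hab : a + 2 * k⁻¹ < b) {S : Set ℝ³}
    (hW : IsWhitneyFamily (whitneyRadius x₀ a b k) {x | 0 < annDepth x₀ a b x} S) {x : ℝ³}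
    (hxS : x ∈ S) (hsmall : annDepth x₀ a b x < 0.9 * k⁻¹) :
    ∃ p ∈ S, 103 / 101 * whitneyRadius x₀ a b k x ≤ whitneyRadius x₀ a b k p ∧
      whitneyRadius x₀ a b k p ≤ 104 / 99 * whitneyRadius x₀ a b k x ∧
      dist x p ≤ 5 * whitneyRadius x₀ a b k x := by
  have hx : 0 < annDepth x₀ a b x := hW.subset hxS
  have hki : 0 < k⁻¹ := inv_pos.2 hk
  -- for a small centre the radius is exactly `d/100`
  have hRx : whitneyRadius x₀ a b k x = annDepth x₀ a b x / 100 := by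
    rw [whitneyRadius_def, max_eq_right (le_min hx.le hki.le), min_eq_left (by linarith)]
  have hρx : 0 < whitneyRadius x₀ a b k x := whitneyRadius_pos hk hx
  -- escape by `3ρ(x)`
  have htd : annDepth x₀ a b x + 3 * whitneyRadius x₀ a b k x ≤ (b - a) / 2 := by
    rw [hRx]; nlinarith
  obtain ⟨y, hxy, hdy⟩ := exists_annDepth_eq_add ha hx (by positivity) htd
  have hy : 0 < annDepth x₀ a b y := by rw [hdy]; positivity
  obtain ⟨p, hpS, hyp⟩ : ∃ p ∈ S, y ∈ ball p (whitneyRadius x₀ a b k p) := by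
    have := hW.cover hy
    simpa only [mem_iUnion, exists_prop] using this
  have hp : 0 < annDepth x₀ a b p := hW.subset hpS
  rw [mem_ball] at hyp
  have hdp := abs_annDepth_sub_le x₀ a b p y
  rw [abs_le, ← dist_eq_norm, dist_comm] at hdp
  have hRp : 100 * whitneyRadius x₀ a b k p = min (annDepth x₀ a b p) k⁻¹ := by
    rw [whitneyRadius_def, max_eq_right (le_min hp.le hki.le)]; ring
  have hRp' : whitneyRadius x₀ a b k p ≤ annDepth x₀ a b p / 100 :=
    whitneyRadius_le_annDepth_div hp.le
  -- upper bound: `99 ρ(p) ≤ 103 ρ(x)`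
  have hup : 99 * whitneyRadius x₀ a b k p ≤ 103 * whitneyRadius x₀ a b k x := by
    rw [hRx]
    have h2 : annDepth x₀ a b p ≤ annDepth x₀ a b y + whitneyRadius x₀ a b k p := by
      linarith [hdp.2]
    rw [hdy, hRx] at h2
    linarith
  refine ⟨p, hpS, ?_, by linarith, ?_⟩
  · rcases le_total (annDepth x₀ a b p) k⁻¹ with h | h
    · rw [min_eq_left h] at hRp
      have h1 : annDepth x₀ a b y - whitneyRadius x₀ a b k p ≤ annDepth x₀ a b p := by
        linarith [hdp.1]
      rw [hdy, hRx] at h1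
      rw [hRx]
      linarith
    · rw [min_eq_right h] at hRp
      rw [hRx]
      nlinarith
  · calc dist x p ≤ dist x y + dist y p := dist_triangle _ _ _
      _ ≤ 3 * whitneyRadius x₀ a b k x + whitneyRadius x₀ a b k p := by rw [hxy]; linarith
      _ ≤ 5 * whitneyRadius x₀ a b k x := by linarith

end Parent

/-! ## Local Hölder and Sobolev on balls, in `ℝ≥0∞` form -/

section LocalIneq

/-- **The two Hölder inequalities of the `Y₆,₁` estimate** (Tao 2011, p. 32: "From Hölder's
inequality we thus have `Y₆,₁ ≲ c^{-0.1}δ² Σᵢ rᵢ^{3/2}‖ω‖²_{L⁶(Bᵢ)}‖ω‖_{L²(2Bᵢ)}`"): on a set `B`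
of finite measure, `∫_B f² g ≤ (∫_B f⁶)^{1/3} (∫ g²)^{1/2} |B|^{1/6}`. [cite: Tao2011, §10, proof of Thm. 10.1 (Hölder step for Y₆,₁, p. 32)] -/
theorem setLIntegral_sq_mul_le {α : Type*} [MeasurableSpace α] {μ : Measure α} {B : Set α}
    {f g : α → ℝ≥0∞} (hf : AEMeasurable f (μ.restrict B)) (hg : AEMeasurable g (μ.restrict B)) :
    ∫⁻ y in B, f y ^ 2 * g y ∂μ ≤
      (∫⁻ y in B, f y ^ 6 ∂μ) ^ (1 / 3 : ℝ) * (∫⁻ y, g y ^ 2 ∂μ) ^ (1 / 2 : ℝ) *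
        (μ B) ^ (1 / 6 : ℝ) := by
  have h3 : (3 : ℝ).HolderConjugate (3 / 2) := Real.holderConjugate_iff.2 ⟨by norm_num, by norm_num⟩
  have h43 : (4 / 3 : ℝ).HolderConjugate 4 := Real.holderConjugate_iff.2 ⟨by norm_num, by norm_num⟩
  -- first Hölder
  have step1 := ENNReal.lintegral_mul_le_Lp_mul_Lq (μ.restrict B) h3 (hf.pow_const 2) hg
  have e1 : ∀ y, (f y ^ 2) ^ (3 : ℝ) = f y ^ 6 := fun y => by
    rw [← ENNReal.rpow_natCast, ← ENNReal.rpow_mul]; norm_num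
  simp_rw [Pi.mul_apply, e1] at step1
  -- second Hölder, against the constant `1`
  have step2 := ENNReal.lintegral_mul_le_Lp_mul_Lq (μ.restrict B) h43 (hg.pow_const (3 / 2 : ℝ))
    aemeasurable_const (g := fun _ => (1 : ℝ≥0∞))
  have e2 : ∀ y, (g y ^ (3 / 2 : ℝ)) ^ (4 / 3 : ℝ) = g y ^ 2 := fun y => by
    rw [← ENNReal.rpow_mul, ← ENNReal.rpow_two]; norm_num
  simp_rw [Pi.mul_apply, mul_one, e2, ENNReal.one_rpow, setLIntegral_const, one_mul] at step2
  have step3 : (∫⁻ y in B, g y ^ (3 / 2 : ℝ) ∂μ) ^ (1 / (3 / 2) : ℝ) ≤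
      (∫⁻ y, g y ^ 2 ∂μ) ^ (1 / 2 : ℝ) * (μ B) ^ (1 / 6 : ℝ) := by
    have hmono : (∫⁻ y in B, g y ^ 2 ∂μ) ≤ ∫⁻ y, g y ^ 2 ∂μ :=
      lintegral_mono' Measure.restrict_le_self le_rfl
    calc (∫⁻ y in B, g y ^ (3 / 2 : ℝ) ∂μ) ^ (1 / (3 / 2) : ℝ)
        ≤ ((∫⁻ y in B, g y ^ 2 ∂μ) ^ (1 / (4 / 3) : ℝ) * (μ B) ^ (1 / 4 : ℝ)) ^ (1 / (3 / 2) : ℝ) :=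
          ENNReal.rpow_le_rpow step2 (by norm_num)
      _ = (∫⁻ y in B, g y ^ 2 ∂μ) ^ (1 / 2 : ℝ) * (μ B) ^ (1 / 6 : ℝ) := by
          rw [ENNReal.mul_rpow_of_nonneg _ _ (by norm_num), ← ENNReal.rpow_mul, ← ENNReal.rpow_mul]
          norm_num
      _ ≤ (∫⁻ y, g y ^ 2 ∂μ) ^ (1 / 2 : ℝ) * (μ B) ^ (1 / 6 : ℝ) :=
          mul_le_mul' (ENNReal.rpow_le_rpow hmono (by norm_num)) le_rfl
  calc ∫⁻ y in B, f y ^ 2 * g y ∂μ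
      ≤ (∫⁻ y in B, f y ^ 6 ∂μ) ^ (1 / 3 : ℝ) * (∫⁻ y in B, g y ^ (3 / 2 : ℝ) ∂μ) ^ (1 / (3 / 2) : ℝ) :=
        step1
    _ ≤ (∫⁻ y in B, f y ^ 6 ∂μ) ^ (1 / 3 : ℝ) *
        ((∫⁻ y, g y ^ 2 ∂μ) ^ (1 / 2 : ℝ) * (μ B) ^ (1 / 6 : ℝ)) := mul_le_mul' le_rfl step3
    _ = _ := by rw [mul_assoc]

/-- `eLpNorm` at the exponents `6` and `2` as lower integrals. [folklore] -/
theorem eLpNorm_six_eq {F : Type*} [NormedAddCommGroup F] (f : EuclideanSpace ℝ (Fin 3) → F)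
    (μ : Measure (EuclideanSpace ℝ (Fin 3))) :
    eLpNorm f 6 μ = (∫⁻ x, ‖f x‖ₑ ^ 6 ∂μ) ^ (1 / 6 : ℝ) := by
  rw [eLpNorm_eq_lintegral_rpow_enorm_toReal (by norm_num) (by norm_num)]
  norm_num

/-- `eLpNorm` at exponent `2` as a lower integral. [folklore] -/
theorem eLpNorm_two_eq' {F : Type*} [NormedAddCommGroup F] (f : EuclideanSpace ℝ (Fin 3) → F)
    (μ : Measure (EuclideanSpace ℝ (Fin 3))) :
    eLpNorm f 2 μ = (∫⁻ x, ‖f x‖ₑ ^ 2 ∂μ) ^ (1 / 2 : ℝ) := by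
  rw [eLpNorm_eq_lintegral_rpow_enorm_toReal (by norm_num) (by norm_num)]
  norm_num

/-- **The local Sobolev inequality on Whitney balls, squared `ℝ≥0∞` form**: there are absolute
constants `K_S, C_S` with
`(∫_{B(x,r)} |f|⁶)^{1/3} ≤ 2K_S² (∫_{B(x,3r)} ‖Df‖² + (C_S/r)² ∫_{B(x,3r)} |f|²)` for all
`C¹` fields `f : ℝ³ → ℝ³` (from the tree's `eLpNorm_six_ball_le`; Tao 2011, p. 32:
"`‖ω‖_{L⁶(Bᵢ)} ≲ ‖∇ω‖_{L²(3Bᵢ)} + rᵢ⁻¹‖ω‖_{L²(3Bᵢ)}`"). [cite: Tao2011, §10, proof of Thm. 10.1 (Sobolev on Whitney balls, p. 32)] -/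
theorem exists_lintegral_six_ball_le :
    ∃ K C : ℝ≥0∞, K ≠ ⊤ ∧ C ≠ ⊤ ∧
      ∀ {f : EuclideanSpace ℝ (Fin 3) → EuclideanSpace ℝ (Fin 3)} (_ : ContDiff ℝ 1 f)
        (x : EuclideanSpace ℝ (Fin 3)) {r : ℝ} (_ : 0 < r),
        (∫⁻ y in ball x r, ‖f y‖ₑ ^ 6) ^ (1 / 3 : ℝ) ≤
          K * ((∫⁻ y in ball x (3 * r), ‖fderiv ℝ f y‖ₑ ^ 2) +
            C * ENNReal.ofReal (r⁻¹ ^ 2) * ∫⁻ y in ball x (3 * r), ‖f y‖ₑ ^ 2) := by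
  obtain ⟨C, hC0, hC⟩ := LocalSobolevBall.eLpNorm_six_ball_le (E := EuclideanSpace ℝ (Fin 3))
    (F := EuclideanSpace ℝ (Fin 3)) finrank_euclideanSpace_fin
  set KS : ℝ≥0∞ := (SNormLESNormFDerivOfEqConst (EuclideanSpace ℝ (Fin 3))
    (volume : Measure (EuclideanSpace ℝ (Fin 3))) 2 : ℝ≥0∞) with hKS
  refine ⟨2 * KS ^ 2, ENNReal.ofReal (C ^ 2), ENNReal.mul_ne_top ENNReal.ofNat_ne_top
    (ENNReal.pow_ne_top ENNReal.coe_ne_top), ENNReal.ofReal_ne_top, fun {f} hf x {r} hr => ?_⟩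
  have h := hC hf x hr
  rw [eLpNorm_six_eq, eLpNorm_two_eq', eLpNorm_two_eq'] at h
  -- square
  have h2 : ((∫⁻ y in ball x r, ‖f y‖ₑ ^ 6) ^ (1 / 6 : ℝ)) ^ (2 : ℝ) ≤
      (KS * ((∫⁻ y in closedBall x (2 * r), ‖fderiv ℝ f y‖ₑ ^ 2) ^ (1 / 2 : ℝ) +
        ENNReal.ofReal (C / r) * (∫⁻ y in closedBall x (2 * r), ‖f y‖ₑ ^ 2) ^ (1 / 2 : ℝ))) ^ (2 : ℝ) :=
    ENNReal.rpow_le_rpow h (by norm_num)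
  rw [← ENNReal.rpow_mul, show (1 / 6 : ℝ) * 2 = 1 / 3 by norm_num, ENNReal.rpow_two, mul_pow] at h2
  refine h2.trans ?_
  have hsub : closedBall x (2 * r) ⊆ ball x (3 * r) := closedBall_subset_ball (by linarith)
  set A := ∫⁻ y in ball x (3 * r), ‖fderiv ℝ f y‖ₑ ^ 2 with hA
  set B := ∫⁻ y in ball x (3 * r), ‖f y‖ₑ ^ 2 with hB
  have hA' : (∫⁻ y in closedBall x (2 * r), ‖fderiv ℝ f y‖ₑ ^ 2) ^ (1 / 2 : ℝ) ≤ A ^ (1 / 2 : ℝ) :=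
    ENNReal.rpow_le_rpow (lintegral_mono_set hsub) (by norm_num)
  have hB' : (∫⁻ y in closedBall x (2 * r), ‖f y‖ₑ ^ 2) ^ (1 / 2 : ℝ) ≤ B ^ (1 / 2 : ℝ) :=
    ENNReal.rpow_le_rpow (lintegral_mono_set hsub) (by norm_num)
  have hsq : ∀ Z : ℝ≥0∞, (Z ^ (1 / 2 : ℝ)) ^ 2 = Z := fun Z => by
    rw [← ENNReal.rpow_two, ← ENNReal.rpow_mul]; norm_num
  have hCr : ENNReal.ofReal (C / r) ^ 2 = ENNReal.ofReal (C ^ 2) * ENNReal.ofReal (r⁻¹ ^ 2) := by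
    rw [← ENNReal.ofReal_pow (div_nonneg hC0 hr.le), ← ENNReal.ofReal_mul (sq_nonneg _), div_eq_mul_inv,
      mul_pow]
  calc KS ^ 2 * ((∫⁻ y in closedBall x (2 * r), ‖fderiv ℝ f y‖ₑ ^ 2) ^ (1 / 2 : ℝ) +
        ENNReal.ofReal (C / r) * (∫⁻ y in closedBall x (2 * r), ‖f y‖ₑ ^ 2) ^ (1 / 2 : ℝ)) ^ 2
      ≤ KS ^ 2 * (A ^ (1 / 2 : ℝ) + ENNReal.ofReal (C / r) * B ^ (1 / 2 : ℝ)) ^ 2 := by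
        gcongr
    _ ≤ KS ^ 2 * (2 * (A ^ (1 / 2 : ℝ)) ^ 2 + 2 * (ENNReal.ofReal (C / r) * B ^ (1 / 2 : ℝ)) ^ 2) :=
        mul_le_mul' le_rfl (PoincareBall.add_sq_le_two_mul_sq_add _ _)
    _ = 2 * KS ^ 2 * (A + ENNReal.ofReal (C ^ 2) * ENNReal.ofReal (r⁻¹ ^ 2) * B) := by
        rw [mul_pow, hsq, hsq, hCr]; ring

/-- **The local velocity-gradient bound in `ℝ≥0∞` form** (`exists_local_velocityGradient_bound`,
`TaoLocalVelocityGradient.lean`): `∫ F² ≤ C ∫_{B(x₀,9r)} |ω|²` and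
`‖Du(y)‖ ≤ F(y) + C r⁻⁴ ∫_{B(y,3r)} |u|` on `B(x₀, r)`. [cite: Tao2011, §10, proof of Thm. 10.1 (local Biot–Savart law, p. 32)] -/
theorem exists_local_velocityGradient_bound_ennreal :
    ∃ C : ℝ, 0 < C ∧ ∀ ⦃u : EuclideanSpace ℝ (Fin 3) → EuclideanSpace ℝ (Fin 3)⦄, ContDiff ℝ 4 u →
      VectorCalculus.IsDivFree u → ∀ (x₀ : EuclideanSpace ℝ (Fin 3)) ⦃r : ℝ⦄, 0 < r →
        ∃ F : EuclideanSpace ℝ (Fin 3) → ℝ≥0∞, Measurable F ∧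
          ∫⁻ y, F y ^ 2 ≤ ENNReal.ofReal C * ∫⁻ y in ball x₀ (9 * r), ‖curl u y‖ₑ ^ 2 ∧
          ∀ y ∈ ball x₀ r, ‖fderiv ℝ u y‖ₑ ≤
            F y + ENNReal.ofReal (C * r⁻¹ ^ 4) * ∫⁻ w in ball y (3 * r), ‖u w‖ₑ := by
  obtain ⟨C, hC0, hC⟩ := exists_local_velocityGradient_bound
  refine ⟨C, hC0, fun u hu hdiv x₀ r hr => ?_⟩
  obtain ⟨F, hFc, hF0, hF2i, hF2, hpt⟩ := hC hu hdiv x₀ hr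
  have hω : Continuous (curl u) := continuous_curl (hu.of_le (by norm_cast))
  refine ⟨fun y => ENNReal.ofReal (F y), ENNReal.measurable_ofReal.comp hFc.measurable, ?_, ?_⟩
  · have e1 : ∫⁻ y, ENNReal.ofReal (F y) ^ 2 = ENNReal.ofReal (∫ y, F y ^ 2) := by
      rw [ofReal_integral_eq_lintegral_ofReal hF2i (Eventually.of_forall fun y => sq_nonneg _)]
      refine lintegral_congr fun y => ?_
      rw [ENNReal.ofReal_pow (hF0 y)]
    have e2 : ∫⁻ y in ball x₀ (9 * r), ‖curl u y‖ₑ ^ 2 =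
        ENNReal.ofReal (∫ y in ball x₀ (9 * r), ‖curl u y‖ ^ 2) := by
      have hc2 : Continuous fun y => ‖curl u y‖ ^ 2 := hω.norm.pow 2
      rw [ofReal_integral_eq_lintegral_ofReal (integrableOn_ball_of_continuous hc2 x₀ (9 * r))
        (Eventually.of_forall fun y => sq_nonneg _)]
      refine lintegral_congr fun y => ?_
      rw [← ofReal_norm, ENNReal.ofReal_pow (norm_nonneg _)]
    rw [e1, e2, ← ENNReal.ofReal_mul hC0.le]
    exact ENNReal.ofReal_le_ofReal hF2
  · intro y hy
    have h := hpt y hy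
    have hI0 : 0 ≤ ∫ w in ball y (3 * r), ‖u w‖ := integral_nonneg fun _ => norm_nonneg _
    have e3 : ∫⁻ w in ball y (3 * r), ‖u w‖ₑ = ENNReal.ofReal (∫ w in ball y (3 * r), ‖u w‖) :=
      (ofReal_integral_norm_eq_lintegral_enorm
        (integrableOn_ball_of_continuous hu.continuous y (3 * r))).symm
    rw [← ofReal_norm, e3, ← ENNReal.ofReal_mul (by positivity), ← ENNReal.ofReal_add (hF0 y)
      (by positivity)]
    exact ENNReal.ofReal_le_ofReal h

end LocalIneq

/-! ## Root-mean-square comparison of adjacent balls (Poincaré) -/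

section RMS

/-- **Minkowski in `L²(B)`**: `‖φ‖_{L²(B)} ≤ ‖φ − ψ‖_{L²(B)} + ‖ψ‖_{L²(B)}`, lower-integral form. [folklore] -/
theorem sqrt_setLIntegral_enorm_sq_le_add {F : Type*} [NormedAddCommGroup F] [MeasurableSpace F]
    [BorelSpace F] [SecondCountableTopology F] {B : Set ℝ³} {φ ψ : ℝ³ → F}
    (hφ : AEMeasurable φ (volume.restrict B)) (hψ : AEMeasurable ψ (volume.restrict B)) :
    (∫⁻ y in B, ‖φ y‖ₑ ^ 2) ^ (1 / 2 : ℝ) ≤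
      (∫⁻ y in B, ‖φ y - ψ y‖ₑ ^ 2) ^ (1 / 2 : ℝ) + (∫⁻ y in B, ‖ψ y‖ₑ ^ 2) ^ (1 / 2 : ℝ) := by
  have hM := ENNReal.lintegral_Lp_add_le (μ := volume.restrict B) (p := 2)
    (f := fun y => ‖φ y - ψ y‖ₑ) (g := fun y => ‖ψ y‖ₑ) (hφ.sub hψ).enorm hψ.enorm one_le_two
  simp only [Pi.add_apply, ENNReal.rpow_two] at hM
  refine le_trans (ENNReal.rpow_le_rpow (lintegral_mono fun y => ?_) (by norm_num)) hM
  have : ‖φ y‖ₑ ≤ ‖φ y - ψ y‖ₑ + ‖ψ y‖ₑ := by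
    calc ‖φ y‖ₑ = ‖(φ y - ψ y) + ψ y‖ₑ := by rw [sub_add_cancel]
      _ ≤ ‖φ y - ψ y‖ₑ + ‖ψ y‖ₑ := enorm_add_le _ _
  exact pow_le_pow_left' this 2

/-- `ofReal (ρᵖ) · ofReal (ρ^q) = ofReal (ρ^{p+q})` for `ρ > 0`. [folklore] -/
theorem ofReal_rpow_mul_ofReal_rpow {ρ : ℝ} (hρ : 0 < ρ) (p q : ℝ) :
    ENNReal.ofReal (ρ ^ p) * ENNReal.ofReal (ρ ^ q) = ENNReal.ofReal (ρ ^ (p + q)) := by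
  rw [← ENNReal.ofReal_mul (Real.rpow_nonneg hρ.le p), Real.rpow_add hρ]

/-- `(ofReal (ρᵖ))^s = ofReal (ρ^{ps})` for `ρ > 0`. [folklore] -/
theorem ofReal_rpow_rpow {ρ : ℝ} (hρ : 0 < ρ) (p s : ℝ) :
    ENNReal.ofReal (ρ ^ p) ^ s = ENNReal.ofReal (ρ ^ (p * s)) := by
  rw [ENNReal.ofReal_rpow_of_pos (Real.rpow_pos_of_pos hρ p), Real.rpow_mul hρ.le]

/-- Volume of a ball of radius `9r` in `ℝ³`, square root: `|B(c, 9r)|^{1/2} = ofReal(27 r^{3/2}) |B₁|^{1/2}`. [folklore] -/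
theorem sqrt_volume_ball_nine (c : ℝ³) {r : ℝ} (hr : 0 < r) :
    (volume (ball c (9 * r))) ^ (1 / 2 : ℝ) =
      ENNReal.ofReal (27 * r ^ (3 / 2 : ℝ)) * (volume (ball (0 : ℝ³) 1)) ^ (1 / 2 : ℝ) := by
  rw [Measure.addHaar_ball volume c (by positivity : (0 : ℝ) ≤ 9 * r), finrank_euclideanSpace_fin,
    ENNReal.mul_rpow_of_nonneg _ _ (by norm_num : (0 : ℝ) ≤ 1 / 2)]
  congr 1
  rw [ENNReal.ofReal_rpow_of_pos (by positivity)]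
  congr 1
  have h9 : (9 : ℝ) ^ (3 / 2 : ℝ) = 27 := by
    rw [show (9 : ℝ) = (3 : ℝ) ^ (2 : ℝ) by norm_num, ← Real.rpow_mul (by norm_num)]
    norm_num
  calc (((9 : ℝ) * r) ^ 3) ^ (1 / 2 : ℝ) = ((9 * r) ^ (3 : ℝ)) ^ (1 / 2 : ℝ) := by norm_cast
    _ = (9 * r) ^ (3 / 2 : ℝ) := by rw [← Real.rpow_mul (by positivity)]; norm_num
    _ = (9 : ℝ) ^ (3 / 2 : ℝ) * r ^ (3 / 2 : ℝ) := Real.mul_rpow (by norm_num) hr.le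
    _ = 27 * r ^ (3 / 2 : ℝ) := by rw [h9]

/-- The root-mean-square of `|ω|` on `B(c, 9r)` (up to the factor `|B₁|^{1/2}·27`):
`m(c, r) = ‖ω‖_{L²(B(c,9r))} r^{-3/2}` (Tao's `wᵢ = (|3Bᵢ|⁻¹∫_{3Bᵢ}|ω|²)^{1/2}`, p. 32). [cite: Tao2011, §10, proof of Thm. 10.1 (the averages wᵢ, p. 32)] -/
def rms (ω : ℝ³ → ℝ³) (c : ℝ³) (r : ℝ) : ℝ≥0∞ :=
  (∫⁻ y in ball c (9 * r), ‖ω y‖ₑ ^ 2) ^ (1 / 2 : ℝ) * ENNReal.ofReal (r ^ (-(3 / 2) : ℝ))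

/-- Unfolding `rms`. [folklore] -/
theorem rms_def (ω : ℝ³ → ℝ³) (c : ℝ³) (r : ℝ) :
    rms ω c r = (∫⁻ y in ball c (9 * r), ‖ω y‖ₑ ^ 2) ^ (1 / 2 : ℝ) *
      ENNReal.ofReal (r ^ (-(3 / 2) : ℝ)) := rfl

/-- **The Poincaré comparison of adjacent averages, (10.24)**: for `ω ∈ C¹`, two balls
`B(w, 9ρ_w)`, `B(p, 9ρ_p)` with `ρ_w ≤ ρ_p ≤ (10/9)ρ_w`, `|w − p| ≤ 5ρ_w` (both inside
`Q = B(w, 15ρ_w)`):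
`m(w) ≤ m(p) + C_P ρ_w^{-1/2} ‖∇ω‖_{L²(Q)}` (Tao: "`|wᵢ − wⱼ| ≲ rᵢ^{-1/2}(∫_{10Bᵢ}|∇ω|²)^{1/2}`
whenever `Bᵢ, Bⱼ` intersect", from the Poincaré inequality on `Q`, here `PoincareBall.lean`,
and Minkowski). [cite: Tao2011, §10, proof of Thm. 10.1 ((10.24), p. 33)] -/
theorem rms_le_rms_add {ω : ℝ³ → ℝ³} (hω : ContDiff ℝ 1 ω) {w p : ℝ³} {ρw ρp : ℝ}
    (hρw : 0 < ρw) (hwp : ρw ≤ ρp) (hpw : ρp ≤ 10 / 9 * ρw) (hdist : dist w p ≤ 5 * ρw) :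
    rms ω w ρw ≤ rms ω p ρp + ENNReal.ofReal (2 * (Real.sqrt 32 * 15)) *
        ENNReal.ofReal (ρw ^ (-(1 / 2) : ℝ)) *
          (∫⁻ y in ball w (15 * ρw), ‖fderiv ℝ ω y‖ₑ ^ 2) ^ (1 / 2 : ℝ) ∧
      rms ω p ρp ≤ rms ω w ρw + ENNReal.ofReal (2 * (Real.sqrt 32 * 15)) *
        ENNReal.ofReal (ρw ^ (-(1 / 2) : ℝ)) *
          (∫⁻ y in ball w (15 * ρw), ‖fderiv ℝ ω y‖ₑ ^ 2) ^ (1 / 2 : ℝ) := by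
  have hρp : 0 < ρp := hρw.trans_le hwp
  set Q := ball w (15 * ρw) with hQ
  set B' := ball w (9 * ρw) with hB'
  set B'' := ball p (9 * ρp) with hB''
  have hB'Q : B' ⊆ Q := ball_subset_ball (by linarith)
  have hB''Q : B'' ⊆ Q := by
    refine ball_subset_ball' ?_
    rw [dist_comm] at hdist
    linarith
  set μ : ℝ³ := ⨍ y in Q, ω y with hμ
  set H := ∫⁻ y in Q, ‖fderiv ℝ ω y‖ₑ ^ 2 with hH
  set V : ℝ≥0∞ := volume (ball (0 : ℝ³) 1) with hV
  have hωm : ∀ S : Set ℝ³, AEMeasurable ω (volume.restrict S) := fun S =>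
    hω.continuous.aemeasurable
  have hcm : ∀ S : Set ℝ³, AEMeasurable (fun _ => μ) (volume.restrict S) := fun S =>
    aemeasurable_const
  -- Poincaré on `Q`
  set PQ := (∫⁻ y in Q, ‖ω y - μ‖ₑ ^ 2) ^ (1 / 2 : ℝ) with hPQ
  have hPoinc : PQ ≤ ENNReal.ofReal (Real.sqrt 32 * 15) * ENNReal.ofReal ρw * H ^ (1 / 2 : ℝ) := by
    have h := PoincareBall.lintegral_ball_sub_average_sq_le (E := ℝ³) (F := ℝ³) hω w
      (by positivity : (0 : ℝ) < 15 * ρw)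
    rw [finrank_euclideanSpace_fin] at h
    have h2 : PQ ≤ ((2 : ℝ≥0∞) ^ 3 * ENNReal.ofReal (4 * (15 * ρw) ^ 2) * H) ^ (1 / 2 : ℝ) :=
      ENNReal.rpow_le_rpow h (by norm_num)
    refine h2.trans (le_of_eq ?_)
    rw [ENNReal.mul_rpow_of_nonneg _ _ (by norm_num)]
    congr 1
    rw [show (2 : ℝ≥0∞) ^ 3 = ENNReal.ofReal 8 by norm_num, ← ENNReal.ofReal_mul (by norm_num),
      ENNReal.ofReal_rpow_of_nonneg (by positivity) (by norm_num), ← ENNReal.ofReal_mul (by positivity)]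
    congr 1
    have h32 : Real.sqrt 32 ^ 2 = 32 := Real.sq_sqrt (by norm_num)
    rw [show (8 : ℝ) * (4 * (15 * ρw) ^ 2) = (Real.sqrt 32 * 15 * ρw) ^ 2 by
      linear_combination (-(225 * ρw ^ 2)) * h32]
    rw [← Real.sqrt_eq_rpow, Real.sqrt_sq (by positivity)]
  have hPB : ∀ {B : Set ℝ³}, B ⊆ Q → (∫⁻ y in B, ‖ω y - μ‖ₑ ^ 2) ^ (1 / 2 : ℝ) ≤ PQ :=
    fun hBQ => ENNReal.rpow_le_rpow (lintegral_mono_set hBQ) (by norm_num)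
  -- the constant on a ball: `(∫_B ‖μ‖²)^{1/2} = ‖μ‖ |B|^{1/2}`
  have hconst : ∀ (c : ℝ³) {r : ℝ}, 0 < r →
      (∫⁻ _ in ball c (9 * r), ‖μ‖ₑ ^ 2) ^ (1 / 2 : ℝ) =
        ‖μ‖ₑ * (ENNReal.ofReal (27 * r ^ (3 / 2 : ℝ)) * V ^ (1 / 2 : ℝ)) := by
    intro c r hr
    have hsq' : ∀ z : ℝ≥0∞, (z ^ 2) ^ (1 / 2 : ℝ) = z := fun z => by
      rw [← ENNReal.rpow_natCast, ← ENNReal.rpow_mul]; norm_num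
    rw [setLIntegral_const, ENNReal.mul_rpow_of_nonneg _ _ (by norm_num : (0 : ℝ) ≤ 1 / 2), hsq',
      sqrt_volume_ball_nine c hr]
  -- (1) and (2): Minkowski on `B'` and `B''`
  have h1 : ∀ (c : ℝ³) {r : ℝ}, 0 < r → ball c (9 * r) ⊆ Q →
      (∫⁻ y in ball c (9 * r), ‖ω y‖ₑ ^ 2) ^ (1 / 2 : ℝ) ≤
        PQ + ‖μ‖ₑ * (ENNReal.ofReal (27 * r ^ (3 / 2 : ℝ)) * V ^ (1 / 2 : ℝ)) := by
    intro c r hr hsub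
    calc (∫⁻ y in ball c (9 * r), ‖ω y‖ₑ ^ 2) ^ (1 / 2 : ℝ)
        ≤ (∫⁻ y in ball c (9 * r), ‖ω y - μ‖ₑ ^ 2) ^ (1 / 2 : ℝ) +
            (∫⁻ _ in ball c (9 * r), ‖μ‖ₑ ^ 2) ^ (1 / 2 : ℝ) :=
          sqrt_setLIntegral_enorm_sq_le_add (hωm _) (hcm _)
      _ ≤ PQ + ‖μ‖ₑ * (ENNReal.ofReal (27 * r ^ (3 / 2 : ℝ)) * V ^ (1 / 2 : ℝ)) := by
          rw [hconst c hr]; exact add_le_add (hPB hsub) le_rfl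
  have h2 : ∀ (c : ℝ³) {r : ℝ}, 0 < r → ball c (9 * r) ⊆ Q →
      ‖μ‖ₑ * (ENNReal.ofReal (27 * r ^ (3 / 2 : ℝ)) * V ^ (1 / 2 : ℝ)) ≤
        PQ + (∫⁻ y in ball c (9 * r), ‖ω y‖ₑ ^ 2) ^ (1 / 2 : ℝ) := by
    intro c r hr hsub
    have hM := sqrt_setLIntegral_enorm_sq_le_add (B := ball c (9 * r)) (hcm _) (hωm _)
    rw [hconst c hr] at hM
    refine hM.trans (add_le_add ?_ le_rfl)
    have e : (fun y => ‖μ - ω y‖ₑ ^ 2) = fun y => ‖ω y - μ‖ₑ ^ 2 := funext fun y => by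
      rw [← enorm_neg, neg_sub]
    rw [e]
    exact hPB hsub
  -- normalisations
  have hn : ∀ {r : ℝ}, 0 < r → ENNReal.ofReal (27 * r ^ (3 / 2 : ℝ)) * ENNReal.ofReal (r ^ (-(3 / 2) : ℝ)) = 27 := by
    intro r hr
    rw [← ENNReal.ofReal_mul (by positivity), mul_assoc, ← Real.rpow_add hr]
    norm_num
  have hcmp : ENNReal.ofReal (ρp ^ (-(3 / 2) : ℝ)) ≤ ENNReal.ofReal (ρw ^ (-(3 / 2) : ℝ)) := by
    refine ENNReal.ofReal_le_ofReal ?_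
    rw [Real.rpow_neg hρp.le, Real.rpow_neg hρw.le]
    exact inv_anti₀ (Real.rpow_pos_of_pos hρw _) (Real.rpow_le_rpow hρw.le hwp (by norm_num))
  have hPQn : PQ * ENNReal.ofReal (ρw ^ (-(3 / 2) : ℝ)) ≤
      ENNReal.ofReal (Real.sqrt 32 * 15) * ENNReal.ofReal (ρw ^ (-(1 / 2) : ℝ)) * H ^ (1 / 2 : ℝ) := by
    calc PQ * ENNReal.ofReal (ρw ^ (-(3 / 2) : ℝ))
        ≤ (ENNReal.ofReal (Real.sqrt 32 * 15) * ENNReal.ofReal ρw * H ^ (1 / 2 : ℝ)) *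
            ENNReal.ofReal (ρw ^ (-(3 / 2) : ℝ)) := mul_le_mul' hPoinc le_rfl
      _ = ENNReal.ofReal (Real.sqrt 32 * 15) * ENNReal.ofReal (ρw ^ (-(1 / 2) : ℝ)) * H ^ (1 / 2 : ℝ) := by
          have : ENNReal.ofReal ρw * ENNReal.ofReal (ρw ^ (-(3 / 2) : ℝ)) =
              ENNReal.ofReal (ρw ^ (-(1 / 2) : ℝ)) := by
            rw [show ENNReal.ofReal ρw = ENNReal.ofReal (ρw ^ (1 : ℝ)) by rw [Real.rpow_one],
              ofReal_rpow_mul_ofReal_rpow hρw]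
            norm_num
          rw [← this]; ring
  -- the key two-sided estimate through the common value `27 V^{1/2} ‖μ‖`
  set Mid := ‖μ‖ₑ * ((27 : ℝ≥0∞) * V ^ (1 / 2 : ℝ)) with hMid
  have hMid : ∀ (c : ℝ³) {r : ℝ}, 0 < r →
      ‖μ‖ₑ * (ENNReal.ofReal (27 * r ^ (3 / 2 : ℝ)) * V ^ (1 / 2 : ℝ)) * ENNReal.ofReal (r ^ (-(3 / 2) : ℝ)) = Mid := by
    intro c r hr
    rw [hMid]
    calc ‖μ‖ₑ * (ENNReal.ofReal (27 * r ^ (3 / 2 : ℝ)) * V ^ (1 / 2 : ℝ)) * ENNReal.ofReal (r ^ (-(3 / 2) : ℝ))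
        = ‖μ‖ₑ * ((ENNReal.ofReal (27 * r ^ (3 / 2 : ℝ)) * ENNReal.ofReal (r ^ (-(3 / 2) : ℝ))) *
            V ^ (1 / 2 : ℝ)) := by ring
      _ = _ := by rw [hn hr]
  -- m(w) ≤ Mid + PQ ρw^{-3/2},  Mid ≤ PQ ρp^{-3/2} + m(p), and the symmetric pair
  have hw1 : rms ω w ρw ≤ PQ * ENNReal.ofReal (ρw ^ (-(3 / 2) : ℝ)) + Mid := by
    rw [rms_def, ← hMid w hρw]
    calc (∫⁻ y in ball w (9 * ρw), ‖ω y‖ₑ ^ 2) ^ (1 / 2 : ℝ) * ENNReal.ofReal (ρw ^ (-(3 / 2) : ℝ))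
        ≤ (PQ + ‖μ‖ₑ * (ENNReal.ofReal (27 * ρw ^ (3 / 2 : ℝ)) * V ^ (1 / 2 : ℝ))) *
            ENNReal.ofReal (ρw ^ (-(3 / 2) : ℝ)) := mul_le_mul' (h1 w hρw hB'Q) le_rfl
      _ = _ := by ring
  have hp1 : rms ω p ρp ≤ PQ * ENNReal.ofReal (ρp ^ (-(3 / 2) : ℝ)) + Mid := by
    rw [rms_def, ← hMid p hρp]
    calc (∫⁻ y in ball p (9 * ρp), ‖ω y‖ₑ ^ 2) ^ (1 / 2 : ℝ) * ENNReal.ofReal (ρp ^ (-(3 / 2) : ℝ))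
        ≤ (PQ + ‖μ‖ₑ * (ENNReal.ofReal (27 * ρp ^ (3 / 2 : ℝ)) * V ^ (1 / 2 : ℝ))) *
            ENNReal.ofReal (ρp ^ (-(3 / 2) : ℝ)) := mul_le_mul' (h1 p hρp hB''Q) le_rfl
      _ = _ := by ring
  have hw2 : Mid ≤ PQ * ENNReal.ofReal (ρw ^ (-(3 / 2) : ℝ)) + rms ω w ρw := by
    rw [rms_def, ← hMid w hρw]
    calc ‖μ‖ₑ * (ENNReal.ofReal (27 * ρw ^ (3 / 2 : ℝ)) * V ^ (1 / 2 : ℝ)) * ENNReal.ofReal (ρw ^ (-(3 / 2) : ℝ))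
        ≤ (PQ + (∫⁻ y in ball w (9 * ρw), ‖ω y‖ₑ ^ 2) ^ (1 / 2 : ℝ)) *
            ENNReal.ofReal (ρw ^ (-(3 / 2) : ℝ)) := mul_le_mul' (h2 w hρw hB'Q) le_rfl
      _ = _ := by ring
  have hp2 : Mid ≤ PQ * ENNReal.ofReal (ρp ^ (-(3 / 2) : ℝ)) + rms ω p ρp := by
    rw [rms_def, ← hMid p hρp]
    calc ‖μ‖ₑ * (ENNReal.ofReal (27 * ρp ^ (3 / 2 : ℝ)) * V ^ (1 / 2 : ℝ)) * ENNReal.ofReal (ρp ^ (-(3 / 2) : ℝ))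
        ≤ (PQ + (∫⁻ y in ball p (9 * ρp), ‖ω y‖ₑ ^ 2) ^ (1 / 2 : ℝ)) *
            ENNReal.ofReal (ρp ^ (-(3 / 2) : ℝ)) := mul_le_mul' (h2 p hρp hB''Q) le_rfl
      _ = _ := by ring
  have hPQp : PQ * ENNReal.ofReal (ρp ^ (-(3 / 2) : ℝ)) ≤ PQ * ENNReal.ofReal (ρw ^ (-(3 / 2) : ℝ)) :=
    mul_le_mul' le_rfl hcmp
  have hfin : PQ * ENNReal.ofReal (ρw ^ (-(3 / 2) : ℝ)) + PQ * ENNReal.ofReal (ρw ^ (-(3 / 2) : ℝ)) ≤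
      ENNReal.ofReal (2 * (Real.sqrt 32 * 15)) * ENNReal.ofReal (ρw ^ (-(1 / 2) : ℝ)) * H ^ (1 / 2 : ℝ) := by
    calc PQ * ENNReal.ofReal (ρw ^ (-(3 / 2) : ℝ)) + PQ * ENNReal.ofReal (ρw ^ (-(3 / 2) : ℝ))
        = 2 * (PQ * ENNReal.ofReal (ρw ^ (-(3 / 2) : ℝ))) := (two_mul _).symm
      _ ≤ 2 * (ENNReal.ofReal (Real.sqrt 32 * 15) * ENNReal.ofReal (ρw ^ (-(1 / 2) : ℝ)) *
          H ^ (1 / 2 : ℝ)) := mul_le_mul' le_rfl hPQn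
      _ = _ := by
          rw [ENNReal.ofReal_mul (by norm_num : (0:ℝ) ≤ 2), ENNReal.ofReal_ofNat]; ring
  constructor
  · calc rms ω w ρw ≤ PQ * ENNReal.ofReal (ρw ^ (-(3 / 2) : ℝ)) + Mid := hw1
      _ ≤ PQ * ENNReal.ofReal (ρw ^ (-(3 / 2) : ℝ)) +
          (PQ * ENNReal.ofReal (ρw ^ (-(3 / 2) : ℝ)) + rms ω p ρp) :=
          add_le_add le_rfl (hp2.trans (add_le_add hPQp le_rfl))
      _ = rms ω p ρp + (PQ * ENNReal.ofReal (ρw ^ (-(3 / 2) : ℝ)) +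
          PQ * ENNReal.ofReal (ρw ^ (-(3 / 2) : ℝ))) := by ring
      _ ≤ _ := add_le_add le_rfl hfin
  · calc rms ω p ρp ≤ PQ * ENNReal.ofReal (ρp ^ (-(3 / 2) : ℝ)) + Mid := hp1
      _ ≤ PQ * ENNReal.ofReal (ρw ^ (-(3 / 2) : ℝ)) +
          (PQ * ENNReal.ofReal (ρw ^ (-(3 / 2) : ℝ)) + rms ω w ρw) := add_le_add hPQp hw2
      _ = rms ω w ρw + (PQ * ENNReal.ofReal (ρw ^ (-(3 / 2) : ℝ)) +
          PQ * ENNReal.ofReal (ρw ^ (-(3 / 2) : ℝ))) := by ring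
      _ ≤ _ := add_le_add le_rfl hfin

end RMS

section PerBall

variable {x₀ : ℝ³} {a b k : ℝ}

/-- **The weight on a dilated Whitney ball, lower bound** (`ℝ≥0∞` form of (10.20)):
`(100 − M) k ρ(x) ≤ η(y)` for `y ∈ B(x, Mρ(x))`, `0 ≤ M < 100`, `d(x) > 0`. [cite: Tao2011, §10, proof of Thm. 10.1 ((10.20))] -/
theorem ofReal_le_ofReal_annularRamp (hk : 0 < k) {M : ℝ} {x y : ℝ³}
    (hx : 0 < annDepth x₀ a b x) (hy : y ∈ ball x (M * whitneyRadius x₀ a b k x)) :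
    ENNReal.ofReal ((100 - M) * k * whitneyRadius x₀ a b k x) ≤
      ENNReal.ofReal (annularRamp k a b ‖y - x₀‖) := by
  refine ENNReal.ofReal_le_ofReal ?_
  have h := annularRamp_ge_of_mem_ball (x₀ := x₀) (a := a) (b := b) hk hy
  rw [annularRamp_eq_mul_whitneyRadius hk hx.le] at h
  linarith

/-- **The weight on a dilated Whitney ball, upper bound**: `η(y) ≤ (100 + M) k ρ(x)` for
`y ∈ B(x, Mρ(x))`. [cite: Tao2011, §10, proof of Thm. 10.1 ((10.20))] -/
theorem ofReal_annularRamp_le_ofReal (hk : 0 < k) {M : ℝ} {x y : ℝ³}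
    (hx : 0 < annDepth x₀ a b x) (hy : y ∈ ball x (M * whitneyRadius x₀ a b k x)) :
    ENNReal.ofReal (annularRamp k a b ‖y - x₀‖) ≤
      ENNReal.ofReal ((100 + M) * k * whitneyRadius x₀ a b k x) := by
  refine ENNReal.ofReal_le_ofReal ?_
  have h := annularRamp_le_of_mem_ball (x₀ := x₀) (a := a) (b := b) hk hy
  rw [annularRamp_eq_mul_whitneyRadius hk hx.le] at h
  linarith

/-- Weighted comparison on a dilated Whitney ball:
`(100 − M)kρ(x) ∫_{B(x,Mρ(x))} f ≤ ∫_{B(x,Mρ(x))} f η`. [cite: Tao2011, §10, proof of Thm. 10.1 ((10.20))] -/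
theorem ofReal_mul_setLIntegral_le_setLIntegral_mul_annularRamp (hk : 0 < k) {M : ℝ} {x : ℝ³}
    (hx : 0 < annDepth x₀ a b x) (f : ℝ³ → ℝ≥0∞) :
    ENNReal.ofReal ((100 - M) * k * whitneyRadius x₀ a b k x) *
        ∫⁻ y in ball x (M * whitneyRadius x₀ a b k x), f y ≤
      ∫⁻ y in ball x (M * whitneyRadius x₀ a b k x), f y * ENNReal.ofReal (annularRamp k a b ‖y - x₀‖) := by
  rw [← lintegral_const_mul' _ _ ENNReal.ofReal_ne_top]
  refine setLIntegral_mono' measurableSet_ball fun y hy => ?_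
  rw [mul_comm]
  exact mul_le_mul' le_rfl (ofReal_le_ofReal_annularRamp hk hx hy)

/-- For a centre of depth `< 0.9 k⁻¹` the Whitney radius is `d/100`. [folklore] -/
theorem whitneyRadius_eq_of_lt (hk : 0 < k) {x : ℝ³} (hx : 0 < annDepth x₀ a b x)
    (hsmall : annDepth x₀ a b x < 0.9 * k⁻¹) :
    whitneyRadius x₀ a b k x = annDepth x₀ a b x / 100 := by
  have hki : 0 < k⁻¹ := inv_pos.2 hk
  rw [whitneyRadius_def, max_eq_right (le_min hx.le hki.le), min_eq_left (by linarith)]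

/-- For a centre of depth `≥ 0.9 k⁻¹` the Whitney radius is at least `0.9 k⁻¹/100`. [folklore] -/
theorem le_whitneyRadius_of_le (hk : 0 < k) {x : ℝ³} (hbig : 0.9 * k⁻¹ ≤ annDepth x₀ a b x) :
    0.9 * k⁻¹ / 100 ≤ whitneyRadius x₀ a b k x := by
  have hki : 0 < k⁻¹ := inv_pos.2 hk
  have hx : 0 < annDepth x₀ a b x := by nlinarith
  rw [whitneyRadius_def, max_eq_right (le_min hx.le hki.le)]
  refine div_le_div_of_nonneg_right (le_min hbig (by linarith)) (by norm_num)

/-- **The layer where `η` is not constant** is `{0 < d < k⁻¹}`, i.e. the union of the two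
transition shells `{a < |y − x₀| < a + k⁻¹} ∪ {b − k⁻¹ < |y − x₀| < b}` (`a + 2k⁻¹ < b`). [folklore] -/
theorem setOf_annDepth_lt_eq (hk : 0 < k) (hab : a + 2 * k⁻¹ < b) :
    {y : ℝ³ | 0 < annDepth x₀ a b y ∧ annDepth x₀ a b y < k⁻¹} =
      {y : ℝ³ | (a < ‖y - x₀‖ ∧ ‖y - x₀‖ < a + k⁻¹) ∨ (b - k⁻¹ < ‖y - x₀‖ ∧ ‖y - x₀‖ < b)} := by
  have hki : 0 < k⁻¹ := inv_pos.2 hk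
  ext y
  simp only [mem_setOf_eq, annDepth_def, lt_min_iff, min_lt_iff, sub_pos]
  constructor
  · rintro ⟨⟨h1, h2⟩, h3 | h3⟩
    · left; exact ⟨h1, by linarith⟩
    · right; exact ⟨by linarith, h2⟩
  · rintro (⟨h1, h2⟩ | ⟨h1, h2⟩)
    · exact ⟨⟨h1, by linarith⟩, Or.inl (by linarith)⟩
    · exact ⟨⟨by linarith, h2⟩, Or.inr (by linarith)⟩

/-- A small Whitney ball lies in the layer: `B(x, ρ(x)) ⊆ {0 < d < k⁻¹}` when
`d(x) < 0.9k⁻¹`. [folklore] -/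
theorem ball_subset_layer (hk : 0 < k) {x : ℝ³} (hx : 0 < annDepth x₀ a b x)
    (hsmall : annDepth x₀ a b x < 0.9 * k⁻¹) :
    ball x (whitneyRadius x₀ a b k x) ⊆ {y : ℝ³ | 0 < annDepth x₀ a b y ∧ annDepth x₀ a b y < k⁻¹} := by
  intro y hy
  have hρ := whitneyRadius_eq_of_lt hk hx hsmall
  have hy' : y ∈ ball x (1 * whitneyRadius x₀ a b k x) := by rwa [one_mul]
  refine ⟨annDepth_pos_of_mem_ball (by norm_num) hx hy', ?_⟩
  rw [mem_ball, dist_eq_norm] at hy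
  have h1 := abs_annDepth_sub_le x₀ a b y x
  rw [abs_le] at h1
  rw [hρ] at hy
  linarith [h1.2]

/-- On a big Whitney ball the weight is at least `0.891`: for `0.9k⁻¹ ≤ d(x)` and
`y ∈ B(x, ρ(x))`, `ofReal 0.891 ≤ η(y)`. [folklore] -/
theorem ofReal_le_annularRamp_of_big (hk : 0 < k) {x y : ℝ³} (hbig : 0.9 * k⁻¹ ≤ annDepth x₀ a b x)
    (hy : y ∈ ball x (whitneyRadius x₀ a b k x)) :
    ENNReal.ofReal 0.891 ≤ ENNReal.ofReal (annularRamp k a b ‖y - x₀‖) := by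
  have hki : 0 < k⁻¹ := inv_pos.2 hk
  have hx : 0 < annDepth x₀ a b x := by nlinarith
  have hy' : y ∈ ball x (1 * whitneyRadius x₀ a b k x) := by rwa [one_mul]
  refine le_trans (ENNReal.ofReal_le_ofReal ?_) (ofReal_le_ofReal_annularRamp (M := 1) hk hx hy')
  have := le_whitneyRadius_of_le hk hbig
  have hk1 : k * k⁻¹ = 1 := mul_inv_cancel₀ hk.ne'
  nlinarith

/-- **The estimate of the nonlinear term on one Whitney ball** (Tao 2011, p. 32: on `Bᵢ`,
`|∇u| ≤ Fᵢ + Gᵢ`, then "`|Y₆| ≤ Y₆,₁ + Y₆,₂`", Hölder and Sobolev for `Y₆,₁`). For a centre `x` of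
positive depth, with `B = B(x, ρ)`, `ρ = ρ(x)`, a function `F` with `|Du| ≤ F + C ρ⁻⁴∫_{B(y,3ρ)}|u|`
on `B`, and the Sobolev bound `(∫_B|ω|⁶)^{1/3} ≤ Sx`:
`∫_B |ω|²|Du| η ≤ 101kρ (Sx (∫F²)^{1/2} |B|^{1/6} + C ρ⁻⁴ (∫_{B(x,4ρ)}|u|) ∫_B |ω|²)`. [cite: Tao2011, §10, proof of Thm. 10.1 (Y₆ on one Whitney ball, p. 32)] -/
theorem setLIntegral_whitneyBall_le (hk : 0 < k) {u : ℝ³ → ℝ³} (hu : ContDiff ℝ 1 u) {x : ℝ³}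
    (hx : 0 < annDepth x₀ a b x) {C : ℝ} {F : ℝ³ → ℝ≥0∞} (hFm : Measurable F)
    (hF : ∀ y ∈ ball x (whitneyRadius x₀ a b k x), ‖fderiv ℝ u y‖ₑ ≤
      F y + ENNReal.ofReal (C * (whitneyRadius x₀ a b k x)⁻¹ ^ 4) *
        ∫⁻ w in ball y (3 * whitneyRadius x₀ a b k x), ‖u w‖ₑ)
    {Sx : ℝ≥0∞} (hS : (∫⁻ y in ball x (whitneyRadius x₀ a b k x), ‖curl u y‖ₑ ^ 6) ^ (1 / 3 : ℝ) ≤ Sx) :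
    ∫⁻ y in ball x (whitneyRadius x₀ a b k x),
        ‖curl u y‖ₑ ^ 2 * ‖fderiv ℝ u y‖ₑ * ENNReal.ofReal (annularRamp k a b ‖y - x₀‖) ≤
      ENNReal.ofReal (101 * k * whitneyRadius x₀ a b k x) *
        (Sx * (∫⁻ y, F y ^ 2) ^ (1 / 2 : ℝ) *
            (volume (ball x (whitneyRadius x₀ a b k x))) ^ (1 / 6 : ℝ) +
          ENNReal.ofReal (C * (whitneyRadius x₀ a b k x)⁻¹ ^ 4) *
            (∫⁻ w in ball x (4 * whitneyRadius x₀ a b k x), ‖u w‖ₑ) *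
              ∫⁻ y in ball x (whitneyRadius x₀ a b k x), ‖curl u y‖ₑ ^ 2) := by
  set r := whitneyRadius x₀ a b k x with hr
  have hr0 : 0 < r := whitneyRadius_pos hk hx
  set B := ball x r with hB
  set L := ∫⁻ w in ball x (4 * r), ‖u w‖ₑ with hL
  set G : ℝ≥0∞ := ENNReal.ofReal (C * r⁻¹ ^ 4) * L with hG
  have hω : Continuous (curl u) := continuous_curl hu
  -- pointwise bound on `B`
  have hpt : ∀ y ∈ B, ‖curl u y‖ₑ ^ 2 * ‖fderiv ℝ u y‖ₑ * ENNReal.ofReal (annularRamp k a b ‖y - x₀‖) ≤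
      ENNReal.ofReal (101 * k * r) * (‖curl u y‖ₑ ^ 2 * F y + G * ‖curl u y‖ₑ ^ 2) := by
    intro y hy
    have hy1 : y ∈ ball x (1 * r) := by rwa [one_mul]
    have hη := ofReal_annularRamp_le_ofReal (M := 1) hk hx hy1
    rw [show (100 + 1 : ℝ) = 101 by norm_num] at hη
    have hsub : ball y (3 * r) ⊆ ball x (4 * r) := by
      refine ball_subset_ball' ?_
      rw [mem_ball] at hy; linarith
    have hDu : ‖fderiv ℝ u y‖ₑ ≤ F y + G :=
      (hF y hy).trans (add_le_add le_rfl (mul_le_mul' le_rfl (lintegral_mono_set hsub)))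
    calc ‖curl u y‖ₑ ^ 2 * ‖fderiv ℝ u y‖ₑ * ENNReal.ofReal (annularRamp k a b ‖y - x₀‖)
        ≤ ‖curl u y‖ₑ ^ 2 * (F y + G) * ENNReal.ofReal (101 * k * r) :=
          mul_le_mul' (mul_le_mul' le_rfl hDu) hη
      _ = ENNReal.ofReal (101 * k * r) * (‖curl u y‖ₑ ^ 2 * F y + G * ‖curl u y‖ₑ ^ 2) := by ring
  -- integrate
  have hωm : AEMeasurable (fun y => ‖curl u y‖ₑ) (volume.restrict B) := hω.aemeasurable.enorm
  have hFm' : AEMeasurable F (volume.restrict B) := hFm.aemeasurable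
  have hHolder := setLIntegral_sq_mul_le (B := B) (μ := volume) hωm hFm'
  calc ∫⁻ y in B, ‖curl u y‖ₑ ^ 2 * ‖fderiv ℝ u y‖ₑ * ENNReal.ofReal (annularRamp k a b ‖y - x₀‖)
      ≤ ∫⁻ y in B, ENNReal.ofReal (101 * k * r) * (‖curl u y‖ₑ ^ 2 * F y + G * ‖curl u y‖ₑ ^ 2) :=
        setLIntegral_mono' measurableSet_ball hpt
    _ = ENNReal.ofReal (101 * k * r) * ((∫⁻ y in B, ‖curl u y‖ₑ ^ 2 * F y) +
          G * ∫⁻ y in B, ‖curl u y‖ₑ ^ 2) := by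
        rw [lintegral_const_mul' _ _ ENNReal.ofReal_ne_top]
        congr 1
        have hm1 : AEMeasurable (fun y => ‖curl u y‖ₑ ^ 2 * F y) (volume.restrict B) :=
          (hωm.pow_const 2).mul hFm'
        rw [lintegral_add_left' hm1, lintegral_const_mul'' _ (hωm.pow_const 2)]
    _ ≤ ENNReal.ofReal (101 * k * r) * (Sx * (∫⁻ y, F y ^ 2) ^ (1 / 2 : ℝ) * (volume B) ^ (1 / 6 : ℝ) +
          G * ∫⁻ y in B, ‖curl u y‖ₑ ^ 2) := by
        refine mul_le_mul' le_rfl (add_le_add ?_ le_rfl)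
        exact hHolder.trans (mul_le_mul' (mul_le_mul' hS le_rfl) le_rfl)

end PerBall

end Y6

end Literature.Analysis.FluidPDE

end
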